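import Literature.Combinatorics.Digraph.RedeiHamiltonianPath
import Mathlib.GroupTheory.Perm.List
import HarnessLib

/-!
# `NoHeavyLowerTail` (crux stmt-CriticalPhenomena-4575), abstract sunflower cubic: TYPE MODEL, part 1 — Hamiltonian paths whose
# start dominates the end (or the last-but-one), and `List.formPerm` bookkeeping for rotations along a path

Support file (seat `prim-ineq-prove-1` gen 40; `--supports stmt-CriticalPhenomena-4575`).  No `sorry`, no named facts.  Memo:
run/shared/lean/prim/prim-ineq-prove-1/FINDING-BIPARTITE-prove1-g40.md (§3 the type model, §4 the injection Ψ).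

THE PROGRAMME.  THEOREM (memo): every BIPARTITE graph core `edgeCore Γ` is A-safe (Lemma A for every number of petals and every
product measure).  Polarisation + symmetrisation + conditioning on one side of the bipartition reduce it to the purely finite
TYPE-MODEL LEMMA `TypeModel.Model.typeModel_lemma` (file `…SunflowerTypeModelLemma`): for K slots, elements with killer types
`τ x ⊆ [K]` and multiplicities, petal labels and an orientation digraph `O`, one has, for every multiplicity profile,
`Σ_{BAD S} (K − |nonA S|)! ≤ (K−1)!·#GOOD`.  The proof is an explicit injection `(S, enumeration) ↦ (Ψ S, key)`: rotate the contents
of the non-A slots along a Hamiltonian path of `O|_N` whose start dominates its end (else its last-but-one), strip the new Z-slot,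
and encode the path reversed in front of the enumeration.

THIS FILE (part 1).  `exists_isHamPath_bypass_or_penultimate`: in a semicomplete digraph on ≥ 2 vertices there is a Hamiltonian path
`u, …, w` with `u → w` ("Hamiltonian bypass") or else one `u, …, w, v` with `u → w` (memo Lemma 4.2: three arc queries on a Rédei path
`v₁ … vₛ` — `v₁vₛ`, `v₁vₛ₋₁`, `vₛvₛ₋₂` — and the paths `vₛ v₁ … vₛ₋₁`, `vₛ₋₁ v₁ … vₛ₋₂ vₛ`).  Helpers: extracting arcs from chains,
transporting `IsHamPath` along list permutations, and `formPerm` of a reversed path (`ρ`: each entry is sent to its predecessor,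
the head to the last entry) — `formPerm_reverse_apply_next`, `formPerm_reverse_apply_head`, `exists_next_of_ne_getLast`.
-/

namespace Summit.CriticalPhenomena.PercolationContinuityZ3.Theorems.SunflowerPartition

namespace TypeModel

open Literature.Combinatorics.Digraph

variable {α : Type*} {r : α → α → Prop}

/-- From a chain ending in `… ++ [a, b]` extract the last step `r a b`. -/
theorem IsChain.rel_of_append_pair {L : List α} {a b : α} (h : (L ++ [a, b]).IsChain r) : r a b := by
  have h2 := (List.isChain_append.1 h).2.1
  exact List.isChain_pair.1 h2

/-- A chain stays a chain after dropping its last entry. -/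
theorem IsChain.dropLast' {L : List α} {b : α} (h : (L ++ [b]).IsChain r) : L.IsChain r :=
  (List.isChain_append.1 h).1

/-- Glue: if `L ++ [a]` is a chain and `r a b` then `L ++ [a, b]` is a chain. -/
theorem IsChain.append_pair {L : List α} {a b : α} (h : (L ++ [a]).IsChain r) (hab : r a b) :
    (L ++ [a, b]).IsChain r := by
  have : L ++ [a, b] = (L ++ [a]) ++ [b] := by simp
  rw [this]
  refine List.IsChain.append h (List.isChain_singleton b) fun x hx y hy => ?_
  simp only [List.getLast?_append, List.getLast?_singleton, Option.some_or, Option.mem_def,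
    Option.some.injEq, List.head?_cons] at hx hy
  subst hx; subst hy; exact hab

/-- Glue: if `r c a` and `a :: L` is a chain then `c :: a :: L` is a chain. -/
theorem IsChain.cons_cons' {L : List α} {c a : α} (h : (a :: L).IsChain r) (hca : r c a) :
    (c :: a :: L).IsChain r := List.isChain_cons_cons.2 ⟨hca, h⟩

/-- Transport of the Hamiltonian-path property along a permutation of the list (same members, no repetition),
given that the new list is a chain. -/
theorem isHamPath_of_perm {N : Finset α} {l l' : List α} (h : IsHamPath r N l) (hp : l.Perm l')
    (hc : l'.IsChain r) : IsHamPath r N l' :=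
  ⟨hp.nodup_iff.1 h.nodup, fun a => by rw [← hp.mem_iff]; exact h.mem_iff a, hc⟩

/-- **Start→end or start→penultimate.**  In a semicomplete digraph on at least two vertices there is a Hamiltonian
path `u, …, w` whose first vertex dominates its last (`r u w`, a "Hamiltonian bypass"), or else a Hamiltonian path
`u, …, w, v` whose first vertex dominates its last-but-one.  (g40 memo Lemma 4.2; the proof queries three arcs.)
[this work] -/
theorem exists_isHamPath_bypass_or_penultimate [DecidableEq α] [DecidableRel r] {N : Finset α}
    (h : Semicomplete r N) (h2 : 2 ≤ N.card) :
    ∃ (u w : α) (mid : List α),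
      (IsHamPath r N (u :: (mid ++ [w])) ∧ r u w) ∨
      (∃ v, IsHamPath r N (u :: (mid ++ [w, v])) ∧ r u w) := by
  obtain ⟨l, hl⟩ := exists_isHamPath (r := r) h
  have hlen : l.length = N.card := hl.length_eq
  -- l = v₁ :: rest with rest nonempty
  obtain ⟨v₁, rest, rfl⟩ : ∃ v₁ rest, l = v₁ :: rest := by
    cases l with
    | nil => simp at hlen; omega
    | cons a t => exact ⟨a, t, rfl⟩
  obtain ⟨init, vs, rfl⟩ : ∃ init vs, rest = init ++ [vs] := by
    rcases List.eq_nil_or_concat rest with h0 | ⟨L, b, hb⟩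
    · subst h0; simp at hlen; omega
    · exact ⟨L, b, by simpa using hb⟩
  -- distinctness helpers
  have hnd := hl.nodup
  have hmem := hl.mem_iff
  have hN : ∀ a, a ∈ v₁ :: (init ++ [vs]) → a ∈ N := fun a ha => (hmem a).1 ha
  by_cases h1s : r v₁ vs
  · exact ⟨v₁, vs, init, Or.inl ⟨hl, h1s⟩⟩
  -- vs → v₁
  have hne1s : v₁ ≠ vs := by
    intro heq; subst heq
    exact (List.nodup_cons.1 hnd).1 (by simp)
  have hs1 : r vs v₁ := by
    rcases h v₁ (hN _ (by simp)) vs (hN _ (by simp)) hne1s with h' | h'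
    · exact absurd h' h1s
    · exact h'
  -- init is nonempty (else r v₁ vs from the chain)
  obtain ⟨init', vp, rfl⟩ : ∃ init' vp, init = init' ++ [vp] := by
    rcases List.eq_nil_or_concat init with h0 | ⟨L, b, hb⟩
    · subst h0
      exact absurd (List.isChain_pair.1 (by simpa using hl.chain)) h1s
    · exact ⟨L, b, by simpa using hb⟩
  -- the path is v₁ :: init' ++ [vp, vs]
  have hshape : v₁ :: (init' ++ [vp] ++ [vs]) = v₁ :: (init' ++ [vp, vs]) := by simp
  rw [hshape] at hl hnd hmem hN
  by_cases h1p : r v₁ vp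
  · exact ⟨v₁, vp, init', Or.inr ⟨vs, hl, h1p⟩⟩
  have hne1p : v₁ ≠ vp := by
    intro heq; subst heq
    exact (List.nodup_cons.1 hnd).1 (by simp)
  have hp1 : r vp v₁ := by
    rcases h v₁ (hN _ (by simp)) vp (hN _ (by simp)) hne1p with h' | h'
    · exact absurd h' h1p
    · exact h'
  -- chain pieces
  have hch : (v₁ :: (init' ++ [vp, vs])).IsChain r := hl.chain
  have hch' : ((v₁ :: init') ++ [vp, vs]).IsChain r := by simpa using hch
  have hps : r vp vs := IsChain.rel_of_append_pair hch'
  have hfront : ((v₁ :: init') ++ [vp]).IsChain r := by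
    have := (List.isChain_append.1 (show (((v₁ :: init') ++ [vp]) ++ [vs]).IsChain r by simpa using hch)).1
    exact this
  -- P₁ := vs :: v₁ :: init' ++ [vp]
  have hP₁chain : (vs :: ((v₁ :: init') ++ [vp])).IsChain r := by
    have : (v₁ :: init') ++ [vp] = v₁ :: (init' ++ [vp]) := rfl
    rw [this] at hfront ⊢
    exact IsChain.cons_cons' hfront hs1
  have hperm₁ : (v₁ :: (init' ++ [vp, vs])).Perm (vs :: ((v₁ :: init') ++ [vp])) := by
    have e : v₁ :: (init' ++ [vp, vs]) = ((v₁ :: init') ++ [vp]) ++ [vs] := by simp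
    rw [e]; exact List.perm_append_singleton _ _
  have hP₁ : IsHamPath r N (vs :: ((v₁ :: init') ++ [vp])) := isHamPath_of_perm hl hperm₁ hP₁chain
  have hnesp : vs ≠ vp := by
    intro heq; subst heq
    have := hnd
    simp [List.nodup_cons, List.nodup_append] at this
  by_cases hsp : r vs vp
  · -- type I with P₁ = vs :: (v₁ :: init') ++ [vp]
    exact ⟨vs, vp, v₁ :: init', Or.inl ⟨by simpa using hP₁, hsp⟩⟩
  -- penultimate of P₁
  rcases List.eq_nil_or_concat init' with h0 | ⟨init'', vq, hq⟩
  · -- init' = [] : P₁ = [vs, v₁, vp], penultimate v₁, and r vs v₁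
    subst h0
    exact ⟨vs, v₁, [], Or.inr ⟨vp, by simpa using hP₁, hs1⟩⟩
  replace hq : init' = init'' ++ [vq] := by simpa using hq
  subst hq
  -- path = v₁ :: init'' ++ [vq, vp, vs];  P₁ = vs :: v₁ :: init'' ++ [vq, vp]
  by_cases hsq : r vs vq
  · refine ⟨vs, vq, v₁ :: init'', Or.inr ⟨vp, ?_, hsq⟩⟩
    simpa using hP₁
  have hvq_mem : vq ∈ N := hN vq (by simp)
  have hvs_mem : vs ∈ N := hN vs (by simp)
  have hnesq : vs ≠ vq := by
    intro heq; subst heq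
    have := hnd
    simp [List.nodup_cons, List.nodup_append] at this
  have hqs : r vq vs := by
    rcases h vs hvs_mem vq hvq_mem hnesq with h' | h'
    · exact absurd h' hsq
    · exact h'
  -- P₂ := vp :: v₁ :: init'' ++ [vq, vs] : chain from r vp v₁, the front chain v₁ :: init'' ++ [vq], and r vq vs
  have hfront' : ((v₁ :: init'') ++ [vq]).IsChain r := by
    have e : (v₁ :: (init'' ++ [vq])) ++ [vp] = ((v₁ :: init'') ++ [vq]) ++ [vp] := by simp
    have h' : (((v₁ :: init'') ++ [vq]) ++ [vp]).IsChain r := by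
      rw [← e]; simpa using hfront
    exact (List.isChain_append.1 h').1
  have hP₂chain : (vp :: ((v₁ :: init'') ++ [vq, vs])).IsChain r := by
    have h' : ((v₁ :: init'') ++ [vq, vs]).IsChain r := IsChain.append_pair hfront' hqs
    have e : (v₁ :: init'') ++ [vq, vs] = v₁ :: (init'' ++ [vq, vs]) := rfl
    rw [e] at h' ⊢
    exact IsChain.cons_cons' h' hp1
  have hperm₂ : (v₁ :: (init'' ++ [vq] ++ [vp, vs])).Perm (vp :: ((v₁ :: init'') ++ [vq, vs])) := by
    have e1 : v₁ :: (init'' ++ [vq] ++ [vp, vs]) = ((v₁ :: init'') ++ [vq]) ++ vp :: [vs] := by simp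
    have e2 : vp :: ((v₁ :: init'') ++ [vq, vs]) = vp :: (((v₁ :: init'') ++ [vq]) ++ [vs]) := by simp
    rw [e1, e2]
    exact List.perm_middle
  have hP₂ : IsHamPath r N (vp :: ((v₁ :: init'') ++ [vq, vs])) := isHamPath_of_perm hl (by simpa using hperm₂) hP₂chain
  exact ⟨vp, vs, (v₁ :: init'') ++ [vq], Or.inl ⟨by simpa using hP₂, hps⟩⟩


variable {α : Type*} [DecidableEq α]

/-- In a repetition-free list, `formPerm` maps an entry to the next one. -/
theorem formPerm_apply_of_append_cons_cons {L L' : List α} {x y : α} (h : (L ++ x :: y :: L').Nodup) :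
    List.formPerm (L ++ x :: y :: L') x = y := by
  have hlen : L.length + 1 < (L ++ x :: y :: L').length := by simp
  have hx : (L ++ x :: y :: L')[L.length]'(by omega) = x := by simp
  have hy : (L ++ x :: y :: L')[L.length + 1]'hlen = y := by
    simp [List.getElem_append_right (by omega : L.length ≤ L.length + 1)]
  have := List.formPerm_apply_lt_getElem (L ++ x :: y :: L') h L.length hlen
  rwa [hx, hy] at this

/-- For `ρ = formPerm l.reverse`: if `a` immediately precedes `b` in `l` then `ρ b = a`. -/
theorem formPerm_reverse_apply_next {L L' : List α} {a b : α} (h : (L ++ a :: b :: L').Nodup) :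
    List.formPerm (L ++ a :: b :: L').reverse b = a := by
  have e : (L ++ a :: b :: L').reverse = L'.reverse ++ b :: a :: L.reverse := by simp
  rw [e]
  apply formPerm_apply_of_append_cons_cons
  rw [← e]; exact List.nodup_reverse.2 h

/-- For `ρ = formPerm l.reverse` with `l = u :: rest`: `ρ u` is the last entry of `l`. -/
theorem formPerm_reverse_apply_head (u : α) (rest : List α) :
    List.formPerm (u :: rest).reverse u = (u :: rest).getLast (List.cons_ne_nil u rest) := by
  rcases List.eq_nil_or_concat rest with h0 | ⟨L, b, hb⟩
  · subst h0; simp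
  · replace hb : rest = L ++ [b] := by simpa using hb
    subst hb
    have e : (u :: (L ++ [b])).reverse = b :: (L.reverse ++ [u]) := by simp
    rw [e, List.formPerm_cons_concat_apply_last]
    simp

/-- `formPerm l.reverse` fixes everything outside `l`. -/
theorem formPerm_reverse_apply_of_notMem {l : List α} {k : α} (h : k ∉ l) : List.formPerm l.reverse k = k :=
  List.formPerm_apply_of_notMem (by simpa using h)

/-- An entry of a repetition-free list other than the last one has a successor:
`l = L ++ k :: k' :: L'`. -/
theorem exists_next_of_ne_getLast {l : List α} {k : α} (hk : k ∈ l) (hne : ∀ h : l ≠ [], k ≠ l.getLast h) :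
    ∃ (L L' : List α) (k' : α), l = L ++ k :: k' :: L' := by
  induction l with
  | nil => simp at hk
  | cons a t ih =>
    by_cases hka : k = a
    · subst hka
      cases t with
      | nil => exact absurd rfl (hne (by simp))
      | cons b t' => exact ⟨[], t', b, rfl⟩
    · have hkt : k ∈ t := (List.mem_cons.1 hk).resolve_left hka
      have ht : t ≠ [] := List.ne_nil_of_mem hkt
      obtain ⟨L, L', k', hL⟩ := ih hkt fun h => by
        have := hne (List.cons_ne_nil a t)
        rwa [List.getLast_cons h] at this
      exact ⟨a :: L, L', k', by simp [hL]⟩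

omit [DecidableEq α] in
/-- Consecutive entries of a chain are related. -/
theorem rel_of_isChain_append_cons_cons {r : α → α → Prop} {L L' : List α} {a b : α}
    (h : (L ++ a :: b :: L').IsChain r) : r a b := by
  have h2 := (List.isChain_append.1 h).2.1
  exact (List.isChain_cons_cons.1 h2).1


end TypeModel

end Summit.CriticalPhenomena.PercolationContinuityZ3.Theorems.SunflowerPartition
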